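import Mathlib
import HarnessLib.Audit
import Summits.PneNP.PneNP.Theorems.PstarReaderCoreSystem
import Summits.PneNP.PneNP.Theorems.PstarGSystemFreeVar
import Summits.PneNP.PneNP.Theorems.PstarGSat
import Summits.PneNP.PneNP.Theorems.PstarGapTwoReadersProof

/-!
# Two constraints: a split reader collapses the core (ROUND-24, the "both-or-neither" step of the `|W| = 2` analysis, memo R10(v))

FRONTIER range-avoidance ladder, rung F-N3, ROUND 24 (cell `pnp-ideate`; restricted-model proof complexity — nothing here bears
on `P` versus `NP`).

Let `(J, W)` be minimal infeasible with `|W| ≤ 2` on a pure typed instance with simple overlaps, maximum degree `Δ`, boundary-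
expanding up to `r ≥ |J|`.  Substitute ALL readers `R` of `J` for their second tips (`PstarReaderCore`): the core `J ∖ R` is minimal
infeasible under the substituted G-constraints (`PstarReaderCoreSystem`).  A reader `g` is SPLIT for a constraint `(C, b)` when
exactly one of its tips lies in `C`; equivalently (`mem_subC_tip_iff`) its first tip `t_g` survives in the substituted linear part
`subC R C`.  Then `t_g` is a FREE variable of the core system (read by no core output, no monomial slot), so row reduction at `t_g`
(`PstarGSystemFreeVar`) leaves at most ONE G-constraint, which by `PstarGSat.gSat` cannot be infeasible on the non-empty expanding core
unless it is the constant contradiction — and then core minimality empties the core.  So `J = R` is a reader family and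
`PstarGapTwoReadersProof.card_le_eight` bounds it: **`card_le_of_split_reader : |J| ≤ 8Δ²`**.  Consequently the `|W| = 2` analysis
(T24.18) may assume that every reader has both or neither of its tips in each of the two constraints (memo ROUND-24-PRESEED §13
R10(v): "a split reader leaves a free variable, the constraints merge, `h = 1`, GSat").
-/

set_option linter.dupNamespace false

open Finset Literature.Computability.Complexity
open scoped symmDiff
open Summit.PneNP.PneNP.Theorems.PstarPDT (parity)
open Summit.PneNP.PneNP.Theorems.PstarTyped (Typed)
open Summit.PneNP.PneNP.Theorems.PstarSALevel (varSet BoundaryExpanding SimpleOverlap)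
open Summit.PneNP.PneNP.Theorems.PstarGapLemma (Sat Feasible MinInfeasible MaxDegree)
open Summit.PneNP.PneNP.Theorems.PstarGapPeeling (feasible_of_boundaryExpanding)
open Summit.PneNP.PneNP.Theorems.PstarGapOneAll (gval)
open Summit.PneNP.PneNP.Theorems.PstarGConstraint (gval_nonconst_iff andPairs_simple)
open Summit.PneNP.PneNP.Theorems.PstarGSat (gSat)
open Summit.PneNP.PneNP.Theorems.PstarGapTwoReaders (IsReader)
open Summit.PneNP.PneNP.Theorems.PstarGapTwoReadersProof (card_le_eight)
open Summit.PneNP.PneNP.Theorems.PstarReaderCore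
open Summit.PneNP.PneNP.Theorems.PstarReaderCoreSystem (ofParity subW core_not_solvable core_erase_solvable)
open Summit.PneNP.PneNP.Theorems.PstarGSystemFreeVar (elimG card_elimG_lt gsat_iff_elimG solves_iff_elimG monomials_elimG)

namespace Summit.PneNP.PneNP.Theorems.PstarGapTwoSplit

variable {n m : ℕ}

/-- **Split readers, in terms of the substituted linear part.**  For a reader `g ∈ R`, its first tip `t_g` lies in `subC R C`
iff exactly one of its two tips lies in `C`. -/
theorem mem_subC_tip_iff (I : LocalMap 4 n m) (hI : I.IsPure xorAndPred) {J R : Finset (Fin m)} (hRJ : R ⊆ J)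
    (hR : ∀ g ∈ R, IsReader I J g) (C : Finset (Fin n)) {g : Fin m} (hg : g ∈ R) :
    I.vars g 0 ∈ subC I R C ↔ ¬ (I.vars g 0 ∈ C ↔ I.vars g 1 ∈ C) := by
  classical
  unfold subC
  have h1 : I.vars g 0 ∈ C \ R.image (fun h => I.vars h 1) ↔ I.vars g 0 ∈ C := by
    rw [mem_sdiff]
    constructor
    · exact fun h => h.1
    · intro h
      refine ⟨h, fun him => ?_⟩
      obtain ⟨h', hh', he⟩ := mem_image.1 him
      exact tip_ne_tip' I hI hRJ hR hg hh' he.symm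
  have h2 : I.vars g 0 ∈ (R.filter fun h => I.vars h 1 ∈ C).image (fun h => I.vars h 0) ↔ I.vars g 1 ∈ C := by
    rw [mem_image]
    constructor
    · rintro ⟨h', hh', he⟩
      rw [← tip_injOn I hRJ hR (mem_filter.1 hh').1 hg he]
      exact (mem_filter.1 hh').2
    · exact fun h => ⟨g, mem_filter.2 ⟨hg, h⟩, rfl⟩
  rw [mem_symmDiff, h1, h2]
  tauto

/-- The value of the empty G-form. -/
theorem gval_empty_empty (I : LocalMap 4 n m) (z : Fin n → Bool) : gval I ∅ ∅ z = false := by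
  simp [PstarGapOneAll.gval, PstarPDT.parity]

/-- **A split reader collapses the core.**  With at most two parity constraints: if, after substituting a set `R` of readers of `J`,
the first tip of some `g ∈ R` survives in a substituted linear part (`g` is split for that constraint), then `J ⊆ R` consists of
readers only, hence `|J| ≤ 8Δ²`.  (Typically `R` = all readers of `J`.) -/
theorem card_le_of_split_reader {Δ r : ℕ} (I : LocalMap 4 n m) (hI : I.IsPure xorAndPred) (hT : Typed I) (hS : SimpleOverlap I)
    (hB : BoundaryExpanding r I) (hD : MaxDegree Δ I) (y : Fin m → Bool) (W : Finset (Finset (Fin n) × Bool)) (J : Finset (Fin m))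
    (hW : W.card ≤ 2) (hJr : J.card ≤ r) (hmin : MinInfeasible I y W J) {R : Finset (Fin m)} (hRJ : R ⊆ J)
    (hR : ∀ g ∈ R, IsReader I J g) {g : Fin m} (hg : g ∈ R) {w : Finset (Fin n) × Bool} (hw : w ∈ W)
    (hsplit : I.vars g 0 ∈ subC I R w.1) : J.card ≤ 8 * Δ ^ 2 := by
  classical
  -- the substituted system and the free variable
  set 𝒲 := (W.image (ofParity m)).image (subW I R y) with h𝒲
  set v := I.vars g 0 with hv
  set w₀ := subW I R y (ofParity m w) with hw₀def
  have hw₀ : w₀ ∈ 𝒲 := mem_image_of_mem _ (mem_image_of_mem _ hw)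
  have hvw₀ : v ∈ w₀.1 := hsplit
  have hvJ : ∀ j ∈ J \ R, v ∉ varSet I j := by
    intro j hj
    have hjg : j ≠ g := fun h => (mem_sdiff.1 hj).2 (h ▸ hg)
    exact hR g hg 0 (by decide) j (mem_sdiff.1 hj).1 hjg
  have hmono : ∀ w' ∈ 𝒲, ∀ h ∈ w'.2.1, h ∈ R := by
    intro w' hw' h hh
    obtain ⟨w₁, hw₁, rfl⟩ := mem_image.1 hw'
    obtain ⟨w₂, -, rfl⟩ := mem_image.1 hw₁
    unfold subW ofParity at hh
    rcases (mem_subG_iff I R _ _ h).1 hh with h0 | h0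
    · exact absurd h0 (notMem_empty _)
    · exact h0.1
  have hvG : ∀ w' ∈ 𝒲, ∀ h ∈ w'.2.1, I.vars h 2 ≠ v ∧ I.vars h 3 ≠ v := fun w' _ h _ =>
    ⟨fun e => hT g h 0 2 (by decide) (by decide) e.symm, fun e => hT g h 0 3 (by decide) (by decide) e.symm⟩
  -- the core is infeasible for the reduced (at most one-constraint) system
  have hcoreJ : (J \ R).card ≤ r := (card_le_card sdiff_subset).trans hJr
  have hcore : ¬ ∃ z : Fin n → Bool, (∀ j ∈ J \ R, I.eval z j = y j) ∧ ∀ w' ∈ elimG 𝒲 w₀ v, gval I w'.1 w'.2.1 z = w'.2.2 := by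
    rw [← solves_iff_elimG I y hw₀ hvw₀ hvJ hvG]
    exact core_not_solvable I hI hT hRJ hR y hmin
  have hcard : (elimG 𝒲 w₀ v).card ≤ 1 := by
    have h1 := card_elimG_lt hw₀ v
    have h2 : 𝒲.card ≤ 2 := card_image_le.trans (card_image_le.trans hW)
    omega
  obtain ⟨z₀, hz₀⟩ := feasible_of_boundaryExpanding I hI hB y (J \ R) hcoreJ
  -- the reduced system is a single contradictory constraint
  have hcontra : ∀ u ∈ elimG 𝒲 w₀ v, ∀ z : Fin n → Bool, gval I u.1 u.2.1 z ≠ u.2.2 := by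
    intro u hu
    have hsingle : elimG 𝒲 w₀ v = {u} := eq_singleton_iff_unique_mem.2 ⟨hu, fun u' hu' => card_le_one.1 hcard u' hu' u hu⟩
    have hcore' : ¬ ∃ z : Fin n → Bool, (∀ j ∈ J \ R, I.eval z j = y j) ∧ gval I u.1 u.2.1 z = u.2.2 := by
      rintro ⟨z, hzJ, hzu⟩
      exact hcore ⟨z, hzJ, fun u' hu' => by rw [hsingle, mem_singleton] at hu'; subst hu'; exact hzu⟩
    -- by `GSat` the constraint is constant …
    have hconst : u.1 = ∅ ∧ u.2.1 = ∅ := by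
      by_contra hne
      have hne' : u.1 ≠ ∅ ∨ u.2.1 ≠ ∅ := by tauto
      have hdisj : Disjoint (J \ R) u.2.1 := by
        rw [disjoint_left]
        intro h hh hhu
        obtain ⟨w', hw', hh'⟩ := monomials_elimG hw₀ hu hhu
        exact (mem_sdiff.1 hh).2 (hmono w' hw' h hh')
      obtain ⟨z, hzJ, hzu⟩ := gSat n m r I hI hT hB hS y (J \ R) u.2.1 u.1 u.2.2 hcoreJ hdisj
        ((gval_nonconst_iff I (andPairs_simple I hI hS _).1 (andPairs_simple I hI hS _).2).2 hne')
      exact hcore' ⟨z, hzJ, hzu⟩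
    -- … and violated by the peeling solution of the core, hence by everything
    intro z hz
    obtain ⟨h1, h2⟩ := hconst
    rw [h1, h2, gval_empty_empty] at hz
    refine hcore' ⟨z₀, hz₀, ?_⟩
    rw [h1, h2, gval_empty_empty, hz]
  -- the core is empty: deleting a core output cannot produce a solution of a contradictory constraint
  have hcore0 : J \ R = ∅ := by
    rcases (elimG 𝒲 w₀ v).eq_empty_or_nonempty with he | ⟨u, hu⟩
    · exfalso
      exact hcore ⟨z₀, hz₀, fun u hu => by rw [he] at hu; exact absurd hu (notMem_empty u)⟩
    · refine eq_empty_of_forall_notMem fun j hj => ?_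
      obtain ⟨z, -, hz𝒲⟩ := core_erase_solvable I hI hRJ hR y hmin hj
      exact hcontra u hu z (((gsat_iff_elimG I hw₀ v z).1 hz𝒲).1 u hu)
  -- so `J` is a reader family
  have hJR : ∀ j ∈ J, IsReader I J j := by
    intro j hj
    by_contra hnot
    have : j ∈ J \ R := mem_sdiff.2 ⟨hj, fun h => hnot (hR j h)⟩
    rw [hcore0] at this
    exact notMem_empty j this
  exact card_le_eight I hI hT hS hD y W J hW hJR hmin

end Summit.PneNP.PneNP.Theorems.PstarGapTwoSplit
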